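import Summits.AnomalousDissipation.AnomalousDissipation.Theses.PumpedMirror
import Literature.Analysis.FluidPDE.NSHopfInvariant
import Literature.Analysis.FunctionSpaces.TorusReflectionCalculus
import Literature.Analysis.FunctionSpaces.TorusFourierSynthesis
import Summits.AnomalousDissipation.AnomalousDissipation.Theorems.TaylorGreenLogLoudStates.Negative.LoadBearing
import Summits.AnomalousDissipation.AnomalousDissipation.Theorems.MirrorVarietyTaylorGreenLoudGalerkinStatesStubDiscreteInfSup

/-!
# Stub `stub_mirrorSchemeFromRest` of the line `registered` (birth skeleton)
# (crux stmt-AnomalousDissipation-15373, `PumpedMirror.MirrorBoundedFromRestTG`)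

**A `K`-symmetric exact-force Hopf–Galerkin scheme from rest for the Taylor–Green force.** For every `ν > 0`
there is a Hopf–Galerkin scheme `(N, U)` (`Literature.Analysis.FluidPDE.IsHopfGalerkinScheme`) with force PINNED
EXACTLY at every order (`F n t = f_TG`) and datum `0`, all of whose slices `U n t` are POINTWISE `K`-symmetric:
`U n t (R_i x) j = (−1)^{δ_ij} U n t x j` for the three coordinate mirrors `R_i x = update x i (−x i)` of `T³`.
This is Hopf's Galerkin construction (Robinson–Rodrigo–Sadowski 2016, Thm. 4.4, Steps 1–2) run inside the closed
subspace of `K`-symmetric trigonometric polynomials (Brachet et al. 1983, §2), exactly parallel to the tree's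
`x_i`-translation-invariant twin `Literature.Analysis.FluidPDE.exists_isHopfGalerkinScheme_invariant`, with
"coefficients vanish at `k_i ≠ 0`" replaced by the mirror relation `c (k R_i) = R_iℂ (c k)` (`R_iℂ` = the sign
flip of the `i`-th coordinate of `ℂ³`; the lemmas take ANY `ℂ`-linear maps `R i` with these coordinates, `hR`,
and the stub instantiates `R i = Matrix.toEuclideanCLM ((reflMat i).map Int.cast)`, the form produced by
`Torus.mFourierCoeff_complexify_conj_mulVecT`):
* §1 reflection algebra on `ℤ³`/`ℂ³` (involution, `|k R_i| = |k|`, invariance of the pairing `k · w`), hence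
  `R_i`-covariance of the Leray symbol (`leraySym_mirror`), of the convection symbol (`convectionCoeff_mirror`:
  reindex both sums by the involution `l ↦ l R_i` of `S`, as in `IsConjSymm.convectionCoeff`) and of the
  Galerkin field (`galerkinField_mirror`);
* §2 the mirror relation on `↥S → ℂ³` is a real subspace (`exists_mirrorSubmodule`) preserved by the Galerkin field
  (`galerkinRHS_mirror`, via `coeffExt_mirror`) — the KEY invariance;
* §3 a real trigonometric polynomial with mirror-related coefficients is `K`-symmetric (`realTrigPoly_mirror`:
  `R_i ∘ u ∘ R_i` and `u` are smooth with equal Fourier coefficients, `Torus.mFourierCoeff_complexify_conj_mulVecT` +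
  `Torus.IsSmooth.ext_mFourierCoeff`); conversely `f̂_TG` is mirror-related (`mFourierCoeff_mirror_of_isKSymm`);
* §4 `f_TG` is its own Galerkin truncation at every order `n + 2` (spectrum on `|k|² = 3 ≤ 4`);
* §5 the stub: `N n = n + 2`, phase space `galerkinSubspace ⊓ mirror subspace`, datum `0`, global solutions by
  `exists_galerkin_solution_of_invariant`, the ten scheme clauses verbatim as in the template.

Sources: E. Hopf, Math. Nachr. 4 (1951) §§2–3; J. C. Robinson, J. L. Rodrigo, W. Sadowski, *The three-dimensional
Navier–Stokes equations* (CUP 2016), Thm. 4.4 Steps 1–2; M. E. Brachet et al., J. Fluid Mech. 130 (1983) §2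
(symmetries of the Taylor–Green vortex); R. Palais, Comm. Math. Phys. 69 (1979). The reflection vocabulary
(`reflMat`, `actVec`, `IsKSymm`, `reflMat_mul_self`, `vecMul_reflMat_apply`, `mulVecT_reflMat_apply`,
`actVec_reflMat_apply`, `isKSymm_tgForce`, `DiscreteInfSup.freqNormSq_vecMul_reflMat`,
`TaylorGreenLogLoudStates.Negative.freqNormSq_of_mem_tgShell`) is reused from the landed MirrorVariety files.
-/

-- `Summit.<Summit>.<Problem>` is the tree's mandated summit-side namespace (CONVENTIONS §2); for this
-- single-conjunct summit the two coincide, so the duplicate is deliberate.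
set_option linter.dupNamespace false

noncomputable section

open scoped BigOperators Topology InnerProductSpace ENNReal
open MeasureTheory Set Filter Function UnitAddTorus
open Literature.Analysis.FunctionSpaces Literature.Analysis.FunctionSpaces.Torus
open Literature.Analysis.FluidPDE Literature.Analysis.FluidPDE.Torus

namespace Summit.AnomalousDissipation.AnomalousDissipation.Theorems.PumpedMirror.MirrorBoundedFromRestTG.SchemeFromRest

open Summit.AnomalousDissipation.AnomalousDissipation.Theorems.TaylorGreenLoudGalerkinStates
open Summit.AnomalousDissipation.AnomalousDissipation.Theorems.TaylorGreenLoudGalerkinStates.Negative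
open Summit.AnomalousDissipation.AnomalousDissipation.Theorems.TaylorGreenLoudGalerkinStates.TgForceRegular
open Summit.AnomalousDissipation.AnomalousDissipation.Theorems.TaylorGreenLoudGalerkinStates.Criticality

/-! ## §1 Reflection algebra on `ℤ³` and `ℂ³` -/

/-- Coordinates of the complex reflection matrix acting on `ℂ³`: `(R_iℂ v)_j = -v_j` if `j = i`, else `v_j`.
[folklore] -/
theorem toEuclideanCLM_reflMat_apply (i : Fin 3) (v : EuclideanSpace ℂ (Fin 3)) (j : Fin 3) :
    Matrix.toEuclideanCLM (n := Fin 3) (𝕜 := ℂ) ((reflMat i).map (Int.cast : ℤ → ℂ)) v j =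
      if j = i then -v j else v j := by
  change (((reflMat i).map (Int.cast : ℤ → ℂ)).mulVec (WithLp.ofLp v)) j = _
  rw [reflMat, Matrix.diagonal_map (Int.cast_zero), Matrix.mulVec_diagonal]
  split_ifs <;> simp

/-- The dual action `k ↦ k R_i` on frequencies is an involution. [folklore] -/
theorem vecMul_reflMat_vecMul_reflMat (k : Fin 3 → ℤ) (i : Fin 3) :
    Matrix.vecMul (Matrix.vecMul k (reflMat i)) (reflMat i) = k := by
  rw [Matrix.vecMul_vecMul, reflMat_mul_self, Matrix.vecMul_one]

section MirrorAlgebra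

variable {R : Fin 3 → (EuclideanSpace ℂ (Fin 3) →L[ℂ] EuclideanSpace ℂ (Fin 3))}
  (hR : ∀ (i : Fin 3) (v : EuclideanSpace ℂ (Fin 3)) (j : Fin 3), R i v j = if j = i then -v j else v j)
include hR

/-- Linear maps with the reflection coordinates ARE the complex reflection matrices. [folklore] -/
theorem mirror_eq_toEuclideanCLM (i : Fin 3) (v : EuclideanSpace ℂ (Fin 3)) :
    R i v = Matrix.toEuclideanCLM (n := Fin 3) (𝕜 := ℂ) ((reflMat i).map (Int.cast : ℤ → ℂ)) v := by
  ext j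
  rw [hR, toEuclideanCLM_reflMat_apply]

/-- `R_iℂ` is an involution of `ℂ³`. [folklore] -/
theorem mirror_mirror (i : Fin 3) (v : EuclideanSpace ℂ (Fin 3)) : R i (R i v) = v := by
  ext j
  simp only [hR]
  split_ifs <;> simp

/-- `freqVec (k R_i) = R_iℂ (freqVec k)`. [folklore] -/
theorem freqVec_vecMul_reflMat (k : Fin 3 → ℤ) (i : Fin 3) :
    freqVec (Matrix.vecMul k (reflMat i)) = R i (freqVec k) := by
  ext j
  rw [hR, freqVec_apply, freqVec_apply, vecMul_reflMat_apply]
  split_ifs <;> push_cast <;> ring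

/-- The bilinear pairing `k · w = ∑ⱼ kⱼ wⱼ` is invariant: `(k R_i) · (R_iℂ w) = k · w`. [folklore] -/
theorem sum_vecMul_reflMat_mul_mirror (k : Fin 3 → ℤ) (i : Fin 3) (w : EuclideanSpace ℂ (Fin 3)) :
    ∑ j, ((Matrix.vecMul k (reflMat i) j : ℤ) : ℂ) * R i w j = ∑ j, (k j : ℂ) * w j := by
  refine Finset.sum_congr rfl fun j _ => ?_
  rw [hR, vecMul_reflMat_apply]
  split_ifs <;> push_cast <;> ring

/-- The same pairing in the order of the convection symbol: `(R_iℂ v) · (m R_i) = v · m`. [folklore] -/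
theorem sum_mirror_mul_vecMul_reflMat (i : Fin 3) (v : EuclideanSpace ℂ (Fin 3)) (m : Fin 3 → ℤ) :
    ∑ j, R i v j * ((Matrix.vecMul m (reflMat i) j : ℤ) : ℂ) = ∑ j, v j * (m j : ℂ) := by
  refine Finset.sum_congr rfl fun j _ => ?_
  rw [hR, vecMul_reflMat_apply]
  split_ifs <;> push_cast <;> ring

/-- **`R_i`-covariance of the Leray symbol**: `Π_{k R_i} (R_iℂ w) = R_iℂ (Π_k w)` (the pairing and `|k|²` are
invariant, `freqVec (k R_i) = R_iℂ (freqVec k)`, and `R_iℂ` is linear). [folklore] -/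
theorem leraySym_mirror (k : Fin 3 → ℤ) (i : Fin 3) (w : EuclideanSpace ℂ (Fin 3)) :
    leraySym (Matrix.vecMul k (reflMat i)) (R i w) = R i (leraySym k w) := by
  rw [leraySym_def, leraySym_def, sum_vecMul_reflMat_mul_mirror hR, DiscreteInfSup.freqNormSq_vecMul_reflMat,
    freqVec_vecMul_reflMat hR, map_sub, map_smul]

/-- **`R_i`-covariance of the convection symbol.** On a frequency set `S` stable under `l ↦ l R_i`, for
coefficient families with `c (l R_i) = R_iℂ (c l)`, `c' (l R_i) = R_iℂ (c' l)`:
`convectionCoeff S c c' (k R_i) = R_iℂ (convectionCoeff S c c' k)` — reindex both sums by the involution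
`l ↦ l R_i` of `S` (as in `IsConjSymm.convectionCoeff`), `l R_i + m R_i = k ↔ l + m = k R_i`, and the pairing
`(R_iℂ c_l) · (m R_i) = c_l · m`. [folklore] -/
theorem convectionCoeff_mirror {S : Finset (Fin 3 → ℤ)} {i : Fin 3}
    (hS : ∀ k ∈ S, Matrix.vecMul k (reflMat i) ∈ S) {c c' : (Fin 3 → ℤ) → EuclideanSpace ℂ (Fin 3)}
    (hc : ∀ l, c (Matrix.vecMul l (reflMat i)) = R i (c l)) (hc' : ∀ l, c' (Matrix.vecMul l (reflMat i)) = R i (c' l))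
    (k : Fin 3 → ℤ) : convectionCoeff S c c' (Matrix.vecMul k (reflMat i)) = R i (convectionCoeff S c c' k) := by
  rw [convectionCoeff_def, convectionCoeff_def, map_sum]
  -- reindex `l ↦ l R_i`, then `m ↦ m R_i`
  refine Finset.sum_nbij' (fun l => Matrix.vecMul l (reflMat i)) (fun l => Matrix.vecMul l (reflMat i)) hS hS
    (fun l _ => vecMul_reflMat_vecMul_reflMat l i) (fun l _ => vecMul_reflMat_vecMul_reflMat l i) fun l _ => ?_
  rw [hc l, map_sum]
  refine Finset.sum_nbij' (fun m => Matrix.vecMul m (reflMat i)) (fun m => Matrix.vecMul m (reflMat i)) hS hS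
    (fun m _ => vecMul_reflMat_vecMul_reflMat m i) (fun m _ => vecMul_reflMat_vecMul_reflMat m i) fun m _ => ?_
  have hiff : Matrix.vecMul l (reflMat i) + Matrix.vecMul m (reflMat i) = k ↔
      l + m = Matrix.vecMul k (reflMat i) := by
    rw [← Matrix.add_vecMul]
    exact ⟨fun h => by rw [← h, vecMul_reflMat_vecMul_reflMat], fun h => by rw [h, vecMul_reflMat_vecMul_reflMat]⟩
  by_cases h : l + m = Matrix.vecMul k (reflMat i)
  · rw [if_pos h, if_pos (hiff.2 h), hc' m, map_smul, mirror_mirror hR, sum_mirror_mul_vecMul_reflMat hR]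
  · rw [if_neg h, if_neg (fun h' => h (hiff.1 h')), map_zero]

/-- **`R_i`-covariance of the Fourier–Galerkin field**: with `S`, `g`, `c` as in `convectionCoeff_mirror`,
`galerkinField ν S g c (k R_i) = R_iℂ (galerkinField ν S g c k)` (the Stokes term is the scalar `|k|²`, the rest is
`leraySym_mirror` and `convectionCoeff_mirror`). [folklore] -/
theorem galerkinField_mirror {S : Finset (Fin 3 → ℤ)} {i : Fin 3}
    (hS : ∀ k ∈ S, Matrix.vecMul k (reflMat i) ∈ S) (ν : ℝ) {g c : (Fin 3 → ℤ) → EuclideanSpace ℂ (Fin 3)}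
    (hg : ∀ l, g (Matrix.vecMul l (reflMat i)) = R i (g l)) (hc : ∀ l, c (Matrix.vecMul l (reflMat i)) = R i (c l))
    (k : Fin 3 → ℤ) : galerkinField ν S g c (Matrix.vecMul k (reflMat i)) = R i (galerkinField ν S g c k) := by
  rw [galerkinField_def, galerkinField_def, DiscreteInfSup.freqNormSq_vecMul_reflMat, hc k, hg k,
    convectionCoeff_mirror hR hS hc hc k, ← map_sub, leraySym_mirror hR]
  simp only [map_add, map_neg, map_smul]

/-! ## §2 Mirror-related coefficient vectors on a reflection-invariant frequency set -/

omit hR in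
/-- Extension by zero respects the mirror relation: if `S` is stable under `k ↦ k R_i` and
`c (k R_i) = R_iℂ (c k)` on `S`, then `coeffExt S c (l R_i) = R_iℂ (coeffExt S c l)` for EVERY `l`
(off `S` both sides vanish). [folklore] -/
theorem coeffExt_mirror {S : Finset (Fin 3 → ℤ)} {i : Fin 3}
    (hS : ∀ k ∈ S, Matrix.vecMul k (reflMat i) ∈ S) {c : ↥S → EuclideanSpace ℂ (Fin 3)}
    (hc : ∀ (k : ↥S) (hk : Matrix.vecMul (k : Fin 3 → ℤ) (reflMat i) ∈ S), c ⟨_, hk⟩ = R i (c k))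
    (l : Fin 3 → ℤ) : coeffExt S c (Matrix.vecMul l (reflMat i)) = R i (coeffExt S c l) := by
  by_cases hl : l ∈ S
  · rw [coeffExt_of_mem c (hS l hl), coeffExt_of_mem c hl]
    exact hc ⟨l, hl⟩ (hS l hl)
  · have hl' : Matrix.vecMul l (reflMat i) ∉ S := fun h => hl (by
      simpa only [vecMul_reflMat_vecMul_reflMat] using hS _ h)
    rw [coeffExt_of_not_mem c hl', coeffExt_of_not_mem c hl, map_zero]

/-- **The mirror-related coefficient vectors form a real subspace** of `↥S → ℂ³`: those `c` with
`c (k R_i) = R_iℂ (c k)` for all three reflections and all `k ∈ S` with `k R_i ∈ S` — the Fourier coordinates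
of the `K`-symmetric trigonometric polynomials over `S` (Brachet et al. 1983, §2). [folklore] -/
theorem exists_mirrorSubmodule (S : Finset (Fin 3 → ℤ)) :
    ∃ W : Submodule ℝ (↥S → EuclideanSpace ℂ (Fin 3)), ∀ c, c ∈ W ↔
      ∀ (i : Fin 3) (k : ↥S) (hk : Matrix.vecMul (k : Fin 3 → ℤ) (reflMat i) ∈ S), c ⟨_, hk⟩ = R i (c k) :=
  ⟨{ carrier := {c | ∀ (i : Fin 3) (k : ↥S) (hk : Matrix.vecMul (k : Fin 3 → ℤ) (reflMat i) ∈ S),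
        c ⟨_, hk⟩ = R i (c k)}
     zero_mem' := fun i k hk => by simp
     add_mem' := fun {c c'} hc hc' i k hk => by
       simp only [Pi.add_apply, map_add, hc i k hk, hc' i k hk]
     smul_mem' := fun a c hc i k hk => by
       ext j
       simp only [Pi.smul_apply, PiLp.smul_apply, hc i k hk, hR]
       split_ifs <;> simp }, fun _ => Iff.rfl⟩

/-- **KEY invariance: the Galerkin field preserves the mirror relation.** On a frequency set stable under the
three dual reflections, if the force coefficients `g` and the state `c` are mirror-related, so is
`galerkinRHS S ν g c` (`galerkinField_mirror` applied to the extensions by zero, `coeffExt_mirror`). [folklore] -/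
theorem galerkinRHS_mirror {S : Finset (Fin 3 → ℤ)} (hS : ∀ (i : Fin 3), ∀ k ∈ S, Matrix.vecMul k (reflMat i) ∈ S)
    (ν : ℝ) {g c : ↥S → EuclideanSpace ℂ (Fin 3)}
    (hg : ∀ (i : Fin 3) (k : ↥S) (hk : Matrix.vecMul (k : Fin 3 → ℤ) (reflMat i) ∈ S), g ⟨_, hk⟩ = R i (g k))
    (hc : ∀ (i : Fin 3) (k : ↥S) (hk : Matrix.vecMul (k : Fin 3 → ℤ) (reflMat i) ∈ S), c ⟨_, hk⟩ = R i (c k)) :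
    ∀ (i : Fin 3) (k : ↥S) (hk : Matrix.vecMul (k : Fin 3 → ℤ) (reflMat i) ∈ S),
      galerkinRHS S ν g c ⟨_, hk⟩ = R i (galerkinRHS S ν g c k) := by
  intro i k hk
  rw [galerkinRHS_apply, galerkinRHS_apply]
  exact galerkinField_mirror hR (hS i) ν (coeffExt_mirror (hS i) (hg i)) (coeffExt_mirror (hS i) (hc i)) k

/-! ## §3 The physical side: mirror-related coefficients ↔ `K`-symmetric fields -/

/-- **Fourier coefficients of a `K`-symmetric field are mirror-related**: for continuous `u` with
`u (R_i x) = R_i (u x)`, `û (k R_i) = R_iℂ (û k)` (`Torus.mFourierCoeff_complexify_conj_mulVecT` with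
`R_i ∘ u ∘ R_i = u`). [folklore] -/
theorem mFourierCoeff_mirror_of_isKSymm {u : UnitAddTorus (Fin 3) → EuclideanSpace ℝ (Fin 3)} (hu : Continuous u)
    (hk : IsKSymm u) (i : Fin 3) (k : Fin 3 → ℤ) :
    mFourierCoeff (EuclideanSpace.complexify ∘ u) (Matrix.vecMul k (reflMat i)) =
      R i (mFourierCoeff (EuclideanSpace.complexify ∘ u) k) := by
  have hfix : (fun y => Matrix.toEuclideanCLM (n := Fin 3) (𝕜 := ℝ) ((reflMat i).map (Int.cast : ℤ → ℝ))
      (u (mulVecT (reflMat i) y))) = u :=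
    (isKSymm_iff_refl_eq u).1 hk i
  have h := mFourierCoeff_complexify_conj_mulVecT hu (reflMat_mul_self i) (reflMat i) (Matrix.vecMul k (reflMat i))
  rw [vecMul_reflMat_vecMul_reflMat, hfix, ← mirror_eq_toEuclideanCLM hR] at h
  exact h

/-- **A real trigonometric polynomial with mirror-related coefficients is `K`-symmetric.** For a symmetric,
reflection-stable `S`, a real coefficient vector `c` on `S` with `c (k R_i) = R_iℂ (c k)`, and
`u = realTrigPoly S (coeffExt S c)`: `u (R_i x) = R_i (u x)` for all `x`. Proof: `R_i ∘ u ∘ R_i` and `u` are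
smooth with the same Fourier coefficients `R_iℂ (ĉ (k R_i)) = R_iℂ (R_iℂ (ĉ k)) = ĉ k`
(`Torus.mFourierCoeff_complexify_conj_mulVecT`, `Torus.mFourierCoeff_realTrigPoly`), hence equal
(`Torus.IsSmooth.ext_mFourierCoeff`); then substitute `x ↦ R_i x` (`R_i² = 1`). [folklore] -/
theorem realTrigPoly_mirror {S : Finset (Fin 3 → ℤ)} (hS : ∀ k ∈ S, -k ∈ S) {i : Fin 3}
    (hSR : ∀ k ∈ S, Matrix.vecMul k (reflMat i) ∈ S) {c : ↥S → EuclideanSpace ℂ (Fin 3)} (hc : IsRealCoeff c)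
    (hcm : ∀ (k : ↥S) (hk : Matrix.vecMul (k : Fin 3 → ℤ) (reflMat i) ∈ S), c ⟨_, hk⟩ = R i (c k))
    (x : UnitAddTorus (Fin 3)) :
    realTrigPoly S (coeffExt S c) (mulVecT (reflMat i) x) = actVec (reflMat i) (realTrigPoly S (coeffExt S c) x) := by
  set L := Matrix.toEuclideanCLM (n := Fin 3) (𝕜 := ℝ) ((reflMat i).map (Int.cast : ℤ → ℝ)) with hL
  have hUs : IsSmooth (realTrigPoly S (coeffExt S c)) := isSmooth_realTrigPoly S _
  have hVs : IsSmooth fun y => L (realTrigPoly S (coeffExt S c) (mulVecT (reflMat i) y)) :=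
    (hUs.comp_mulVecT' (reflMat i)).comp_clm L
  -- the Fourier coefficients of `u` are the extended coefficients
  have hcoefU : ∀ k, mFourierCoeff (EuclideanSpace.complexify ∘ realTrigPoly S (coeffExt S c)) k = coeffExt S c k := by
    intro k
    rw [mFourierCoeff_realTrigPoly hS (hc.isConjSymm_coeffExt hS)]
    by_cases hk : k ∈ S <;> simp [hk, coeffExt_of_not_mem]
  -- the conjugated field has the same coefficients
  have hcoef : ∀ k, mFourierCoeff (EuclideanSpace.complexify ∘ fun y =>
      L (realTrigPoly S (coeffExt S c) (mulVecT (reflMat i) y))) k =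
      mFourierCoeff (EuclideanSpace.complexify ∘ realTrigPoly S (coeffExt S c)) k := by
    intro k
    rw [hL, mFourierCoeff_complexify_conj_mulVecT hUs.continuous (reflMat_mul_self i) (reflMat i) k, hcoefU, hcoefU,
      coeffExt_mirror hSR hcm k, ← mirror_eq_toEuclideanCLM hR, mirror_mirror hR]
  have heq := IsSmooth.ext_mFourierCoeff hVs.complexify_comp hUs.complexify_comp hcoef
  -- evaluate `L ∘ u ∘ R_i = u` at `R_i x` (`R_i² = 1`): `L (u x) = u (R_i x)`
  have h : L (realTrigPoly S (coeffExt S c) (mulVecT (reflMat i) (mulVecT (reflMat i) x))) =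
      realTrigPoly S (coeffExt S c) (mulVecT (reflMat i) x) := EuclideanSpace.complexify_injective (congrFun heq _)
  rw [mulVecT_mulVecT] at h
  rw [← h, actVec_eq_toEuclideanCLM]

end MirrorAlgebra

/-- The torus-side reflection of the crux is the tree's `Torus.mulVecT (reflMat i)`:
`update x i (-x i) = R_i • x`. [folklore] -/
theorem update_neg_eq_mulVecT (x : UnitAddTorus (Fin 3)) (i : Fin 3) :
    Function.update x i (-x i) = mulVecT (reflMat i) x := by
  funext l
  rw [mulVecT_reflMat_apply]
  rcases eq_or_ne l i with rfl | h <;> simp [*]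

/-! ## §4 The force slot: `f_TG` is its own Galerkin truncation -/

/-- `f_TG` is band-limited to `|k|² ≤ (n + 2)²` for every `n`: its spectrum is the shell `|k|² = 3 ≤ 4`.
[folklore] -/
theorem mFourierCoeff_tgForce_eq_zero_of_lt (n : ℕ) (k : Fin 3 → ℤ) (hk : ((n + 2 : ℕ) : ℝ) ^ 2 < freqNormSq k) :
    mFourierCoeff (EuclideanSpace.complexify ∘ tgForce) k = 0 := by
  rw [mFourierCoeff_tgForce, if_neg]
  intro hmem
  rw [TaylorGreenLogLoudStates.Negative.freqNormSq_of_mem_tgShell hmem] at hk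
  have h2 : (2 : ℝ) ≤ ((n + 2 : ℕ) : ℝ) := by exact_mod_cast Nat.le_add_left 2 n
  nlinarith

/-- **The exact force is a Galerkin force at every order**: the real trigonometric polynomial on
`freqBall (n + 2)` with the Fourier coefficients of `f_TG` IS `f_TG` (`Torus.fourierTruncate_eq_self`). [folklore] -/
theorem realTrigPoly_mFourierCoeff_tgForce (n : ℕ) :
    realTrigPoly (freqBall (n + 2)) (coeffExt (freqBall (n + 2))
      (fun k : ↥(freqBall (d := Fin 3) (n + 2)) => mFourierCoeff (EuclideanSpace.complexify ∘ tgForce) k)) = tgForce := by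
  rw [realTrigPoly_coeffExt_restrict, ← fourierTruncate_eq]
  exact fourierTruncate_eq_self continuous_tgForce (mFourierCoeff_tgForce_eq_zero_of_lt n)

/-! ## §5 The registered stub -/

/-- **Stub A — `K`-symmetric exact-force Hopf–Galerkin scheme from rest for `f_TG`** (the `Fix K` twin of
`Literature.Analysis.FluidPDE.exists_isHopfGalerkinScheme_invariant`; Robinson–Rodrigo–Sadowski 2016, Thm. 4.4
Steps 1–2, run in the closed subspace of `K`-symmetric trigonometric polynomials, Brachet et al. 1983 §2): for
every `ν > 0` there is a Hopf–Galerkin scheme `(N, U)` for `(ν, f_TG, 0)` driven at every order by the exact force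
`f_TG`, all of whose slices `U n t`, `t ≥ 0`, are pointwise `K`-symmetric:
`U n t (R_i x) j = (−1)^{δ_ij} U n t x j`, `R_i x = update x i (−x i)`. Construction: `N n = n + 2`; force
coefficients `f̂_TG(k)` (constant in time, real, mirror-related, and synthesising `f_TG` exactly on
`freqBall (n + 2)`); phase space `galerkinSubspace ⊓ {mirror-related}` (invariant by `galerkinRHS_mem` and
`galerkinRHS_mirror`); datum `0`; global solutions by `exists_galerkin_solution_of_invariant`; the scheme clauses
by `galerkin_test_identity`, `galerkin_energy_identity`, `galerkin_slice_props`, `continuousOn_stLift_realTrigPoly`;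
the symmetry by `realTrigPoly_mirror`. [folklore] -/
theorem stub_mirrorSchemeFromRest :
    ∀ f : UnitAddTorus (Fin 3) → EuclideanSpace ℝ (Fin 3), f = (fun x => !₂[(fourier 1 (x 0) : ℂ).im * (fourier 1 (x 1) : ℂ).re * (fourier 1 (x 2) : ℂ).re, -((fourier 1 (x 0) : ℂ).re * (fourier 1 (x 1) : ℂ).im * (fourier 1 (x 2) : ℂ).re), (0 : ℝ)]) →
      ∀ ν : ℝ, 0 < ν →
        ∃ (N : ℕ → ℕ) (U : ℕ → ℝ → UnitAddTorus (Fin 3) → EuclideanSpace ℝ (Fin 3)),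
          Literature.Analysis.FluidPDE.IsHopfGalerkinScheme ν (fun _ => f) 0 N (fun _ _ => f) U ∧
          ∀ (n : ℕ) (t : ℝ), 0 ≤ t → ∀ (i j : Fin 3) (x : UnitAddTorus (Fin 3)),
            U n t (Function.update x i (-x i)) j = if j = i then -(U n t x j) else U n t x j := by
  intro f hf ν hν
  obtain rfl : f = tgForce := hf
  -- the complex reflection matrices and their coordinates
  set R : Fin 3 → (EuclideanSpace ℂ (Fin 3) →L[ℂ] EuclideanSpace ℂ (Fin 3)) :=
    fun i => Matrix.toEuclideanCLM (n := Fin 3) (𝕜 := ℂ) ((reflMat i).map (Int.cast : ℤ → ℂ))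
  have hR : ∀ (i : Fin 3) (v : EuclideanSpace ℂ (Fin 3)) (j : Fin 3), R i v j = if j = i then -v j else v j :=
    fun i v j => toEuclideanCLM_reflMat_apply i v j
  -- the frequency sets `freqBall (n + 2)`: symmetric and stable under the dual reflections
  have hS : ∀ n : ℕ, ∀ k ∈ freqBall (d := Fin 3) (n + 2), -k ∈ freqBall (n + 2) := fun n =>
    neg_mem_freqBall_of_mem
  have hSR : ∀ (n : ℕ) (i : Fin 3), ∀ k ∈ freqBall (d := Fin 3) (n + 2),
      Matrix.vecMul k (reflMat i) ∈ freqBall (n + 2) := fun n i k hk =>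
    (DiscreteInfSup.vecMul_reflMat_mem_freqBall_iff k i (n + 2)).2 hk
  -- the force coefficients: `f̂_TG` restricted to the ball, constant in time, real and mirror-related
  set g : (n : ℕ) → ℝ → (↥(freqBall (d := Fin 3) (n + 2)) → EuclideanSpace ℂ (Fin 3)) :=
    fun n _ k => mFourierCoeff (EuclideanSpace.complexify ∘ tgForce) k
  have hg_real : ∀ n t, IsRealCoeff (g n t) := fun n t =>
    isRealCoeff_mFourierCoeff isSmooth_tgForce.integrable
  have hg_cont : ∀ n, Continuous (g n) := fun n => continuous_const
  have hg_mirror : ∀ (n : ℕ) (t : ℝ) (i : Fin 3) (k : ↥(freqBall (d := Fin 3) (n + 2)))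
      (hk : Matrix.vecMul (k : Fin 3 → ℤ) (reflMat i) ∈ freqBall (n + 2)), g n t ⟨_, hk⟩ = R i (g n t k) :=
    fun n t i k hk => mFourierCoeff_mirror_of_isKSymm hR continuous_tgForce isKSymm_tgForce i k
  -- the force trigonometric polynomial IS `f_TG` at every order
  have hforce : ∀ (n : ℕ) (t : ℝ), realTrigPoly (freqBall (n + 2)) (coeffExt (freqBall (n + 2)) (g n t)) = tgForce :=
    fun n t => realTrigPoly_mFourierCoeff_tgForce n
  -- the phase spaces: real, divergence-free, mirror-related coefficient vectors
  choose W hW using fun n : ℕ => exists_mirrorSubmodule hR (freqBall (d := Fin 3) (n + 2))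
  set W' : (n : ℕ) → Submodule ℝ (↥(freqBall (d := Fin 3) (n + 2)) → EuclideanSpace ℂ (Fin 3)) :=
    fun n => galerkinSubspace (freqBall (n + 2)) ⊓ W n
  have hWle : ∀ n, W' n ≤ galerkinSubspace (freqBall (n + 2)) := fun n => inf_le_left
  have hWinv : ∀ n t, ∀ c ∈ W' n, galerkinRHS (freqBall (n + 2)) ν (g n t) c ∈ W' n := fun n t c hc =>
    Submodule.mem_inf.2 ⟨galerkinRHS_mem ν (hS n) (hg_real n t) (Submodule.mem_inf.1 hc).1,
      (hW n _).2 (galerkinRHS_mirror hR (hSR n) ν (hg_mirror n t) ((hW n _).1 (Submodule.mem_inf.1 hc).2))⟩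
  have hc₀ : ∀ n, (0 : ↥(freqBall (d := Fin 3) (n + 2)) → EuclideanSpace ℂ (Fin 3)) ∈ W' n := fun n =>
    zero_mem _
  -- the global Galerkin solutions from rest, inside the invariant subspaces
  have hsol : ∀ n : ℕ, ∃ α : ℝ → ↥(freqBall (d := Fin 3) (n + 2)) → EuclideanSpace ℂ (Fin 3),
      α 0 = 0 ∧ (∀ t, α t ∈ W' n) ∧ ContinuousOn α (Ici 0) ∧
      ∀ T, ∀ t ∈ Icc 0 T, HasDerivWithinAt α (galerkinRHS (freqBall (n + 2)) ν (g n t) (α t))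
        (Icc 0 T) t := fun n =>
    exists_galerkin_solution_of_invariant ν hν.le (hS n) (hg_cont n) (hg_real n) (W' n) (hWle n)
      (hWinv n) (hc₀ n)
  choose α hα0 hαW hαcont hαderiv using hsol
  have hαmem : ∀ n t, α n t ∈ galerkinSubspace (freqBall (n + 2)) := fun n t => hWle n (hαW n t)
  have hαmirror : ∀ (n : ℕ) (t : ℝ) (i : Fin 3) (k : ↥(freqBall (d := Fin 3) (n + 2)))
      (hk : Matrix.vecMul (k : Fin 3 → ℤ) (reflMat i) ∈ freqBall (n + 2)), α n t ⟨_, hk⟩ = R i (α n t k) :=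
    fun n t => (hW n _).1 (Submodule.mem_inf.1 (hαW n t)).2
  -- the datum is zero
  have hU0 : ∀ n, realTrigPoly (freqBall (n + 2)) (coeffExt (freqBall (n + 2)) (α n 0)) = 0 := fun n => by
    rw [hα0 n, coeffExt_zero, realTrigPoly_zero]
  -- band-limitation of Galerkin modes in `Finset` form
  have hband : ∀ {n : ℕ} {a : UnitAddTorus (Fin 3) → EuclideanSpace ℝ (Fin 3)}, IsGalerkinMode (n + 2) a →
      ∀ k ∉ freqBall (d := Fin 3) (n + 2), mFourierCoeff (EuclideanSpace.complexify ∘ a) k = 0 :=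
    fun ha k hk => ha.mFourierCoeff_eq_zero (not_mem_freqBall.1 hk)
  refine ⟨fun n => n + 2, fun n t => realTrigPoly (freqBall (n + 2)) (coeffExt (freqBall (n + 2)) (α n t)),
    ?_, ?_⟩
  · exact
      { tendsto_order := tendsto_add_atTop_nat 2
        smooth_force := fun n => isSmooth_tgForce.comp contDiff_snd
        tendsto_force := fun T _ => by
          have h0 : (fun n : ℕ => ∫⁻ t in Ioo 0 T, ∫⁻ x, ‖tgForce x - tgForce x‖ₑ ^ 2) = fun _ => 0 := by
            funext n; simp
          show Tendsto (fun n : ℕ => ∫⁻ t in Ioo 0 T, ∫⁻ x, ‖tgForce x - tgForce x‖ₑ ^ 2) atTop (𝓝 0)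
          rw [h0]; exact tendsto_const_nhds
        continuousOn := fun n => continuousOn_stLift_realTrigPoly (hαcont n)
        isGalerkinMode := fun n t _ =>
          have h := galerkin_slice_props (hS n) (hαmem n t)
          ⟨h.1, h.2.1, fun k hk => h.2.2.2 k (not_mem_freqBall.2 hk)⟩
        isWeaklyDivFree := fun n t _ => (galerkin_slice_props (hS n) (hαmem n t)).2.2.1
        galerkin := fun n a ha s t hs hst => by
          have h := galerkin_test_identity ν (hS n) (hg_cont n) (hg_real n) (hαmem n) (hαderiv n)
            ha.isSmooth ha.isDivFree (hband ha) hs hst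
          simp only [hforce] at h
          exact h
        energy_eq := fun n s t hs hst => by
          have h := galerkin_energy_identity ν (hS n) (hg_cont n) (hg_real n) (hαmem n) (hαderiv n) hs hst
          simp only [hforce] at h
          exact h
        initial_inner := fun n a ha => by rw [hU0 n]
        tendsto_initial := by
          have heq : (fun n => eLpNorm (realTrigPoly (freqBall (n + 2))
              (coeffExt (freqBall (n + 2)) (α n 0)) - 0) 2 volume) = fun _ => 0 := by
            funext n; rw [hU0 n, sub_zero, eLpNorm_zero]
          rw [heq]; exact tendsto_const_nhds }
  · -- pointwise `K`-symmetry of every slice, read off from the mirror relation of its coefficients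
    intro n t _ i j x
    beta_reduce
    rw [update_neg_eq_mulVecT, realTrigPoly_mirror hR (hS n) (hSR n i) (hαmem n t).1 (hαmirror n t i) x,
      actVec_reflMat_apply]

end Summit.AnomalousDissipation.AnomalousDissipation.Theorems.PumpedMirror.MirrorBoundedFromRestTG.SchemeFromRest

end
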